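import Summits.CriticalPhenomena.Ising3DConformalLimit.Theses.UnitLightCone
import Summits.CriticalPhenomena.Ising3DConformalLimit.Theses.HyperoctahedralRP
import Summits.CriticalPhenomena.Ising3DConformalLimit.Theses.IsingEuclidUpgrade
import Summits.CriticalPhenomena.Ising3DConformalLimit.Theorems.LeeYangGapGaussianLimitKillsBlockCoupling
import Summits.CriticalPhenomena.Ising3DConformalLimit.Theorems.PerfectScreeningCoulombImpliesNontrivialBlockFieldDomination
import Literature.Probability.LatticeModels.PointwiseScalingLimitScaleCovariant
import Literature.Probability.LatticeModels.HighDimPointwiseTriviality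
import Literature.Barriers.CriticalPhenomena.IsingTrivialityFromDimensionFourProofs
import HarnessLib

/-!
# Typed split of crux `IsingEuclidUpgradeR4NonGaussian` (stmt-CriticalPhenomena-0636) — the ISOTHERM-DEFICIT split

Crux (shared decl of routes UnitLightCone / HyperoctahedralRP / IsingEuclidUpgrade …, item stmt-CriticalPhenomena-0636):
`∀ ρ S, (∀ δ ∈ Ioc 0 1, 0 < ρ δ) → HasPointwiseScalingLimit (criticalCorr 3) ρ S → IsNondegenerateTwoPoint S →
HasNontrivialU4 S` — every non-degenerate pointwise scaling limit of the critical Ising₃ correlators is non-Gaussian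
at the four-point level.

This file is the SORRY-FREE GLUE `IsingEuclidUpgradeR4NonGaussian_of_subs : Sub₂ → Sub₁ → Crux` of the two-piece
split (crux-strategist protocol (b); the two pieces are spelled out verbatim as hypotheses — no `def`, no named fact is
introduced, pure proofs):

* `Sub₁ = MatchedIsothermDeficit` (crux-child, OPEN): for every non-degenerate scale-covariant pointwise limit
  (the hypotheses are only TOOLS — regular variation of the critical two-point function; the conclusion is a pure
  lattice inequality) there are `C > 0`, `c > 0` such that for INFINITELY MANY `L`, with `Σ_L = ⟨M_L²⟩_{β_c}`,
  `M_L = Σ_{x ∈ box 3 L} σ_x` and the matched field `h_L = C/√Σ_L`,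
  `(2L+1)³ · m(β_c, h_L) ≤ (1 - c) · β_c C √Σ_L` (`= (1 - c)·(β_c h_L)·Σ_L`, a DEFICIT of the infinite-volume
  critical magnetisation below the naive linear response of the block at `C` Zeeman standard deviations).
  This is the weakest isotherm statement that still closes the crux through the chain below: any deficit `c > 0`
  (not `1/2`) and a subsequence of scales (not all large `L`) suffice. In exponent language it is the
  hyperscaling equality for `δ` read as an UPPER bound on `m(β_c,·)` with amplitude; predicted true on `ℤ³`,
  false for `d ≥ 5` (the field is anomalously relevant there), so it carries the `d < 4` input the crux needs.
* `Sub₂ = LeeYangDeficit` (support, provable now from the landed Lee–Yang package of the critical block law,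
  `stub_blockLaw` + `stub_leeYangPackage` of route PerfectScreening): for every tilt `t ≥ 0`,
  `(Σ_L t - t³(3Σ_L² - ⟨M_L⁴⟩))·⟨e^{tM_L}⟩ ≤ ⟨M_L e^{tM_L}⟩` — the deficit of the tilted block mean below its
  linear response is at most `t³·(-u₄(M_L))` (Newman 1975).

Glue: at a scale `L` where Sub₁ bites, put `t = β_c h_L`; GKS block-field domination (LANDED,
`PerfectScreeningCoulombImpliesNontrivial.stub_blockFieldDomination`: `⟨M e^{tM}⟩ ≤ (2L+1)³ m(β_c,h_L) ⟨e^{tM}⟩`)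
and Sub₂ give `Σ_L t - t³(3Σ_L²-⟨M⁴⟩) ≤ (1-c) t Σ_L`, i.e. the block Binder coupling
`g_L := (3Σ_L² - ⟨M_L⁴⟩)/Σ_L² ≥ c/(β_c² C²)` (`binder_lower_of_deficit`); so `g_L ≥ c₀ > 0` frequently, whereas a
non-degenerate pointwise limit with `U₄ ≡ 0` forces `g_L → 0` (LANDED, `gaussianLimitKillsBlockCoupling_proof`,
item stmt-CriticalPhenomena-4950; scale covariance of a normalised limit is automatic,
`HasPointwiseScalingLimit.exists_rpow_scale_mem_Icc`). The registered strategist line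
`Cruxes/IsingEuclidUpgradeR4NonGaussian/Lines/isotherm_saturation_lee_yang.lean` feeds Sub₁: its stub S1
(`stub_matchedUpperIsotherm`, deficit `1/2` eventually) implies Sub₁ (`matchedIsothermDeficit_of_matchedUpperIsotherm`),
and so does its one-arm entrance S3 → S4 (item stmt-CriticalPhenomena-15591).

References: C. M. Newman, Comm. Pure Appl. Math. 27 (1974) 143–159 and Z. Wahrscheinlichkeitstheorie 33 (1975)
75–93 (Lee–Yang class, `u₄` sign and Gaussian criterion) [Newman1975]; F. Camia, C. Garban, C. M. Newman, Ann. IHP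
52 (2016) = arXiv:1307.3926 Thm 1.1 / Prop 2.2 (planar template: isotherm ⟹ non-Gaussian field)
[CamiaGarbanNewman2016]; M. Aizenman, H. Duminil-Copin, Ann. Math. 194 (2021) = arXiv:1912.07973 Prop 1.4
[AizenmanDuminilCopinAnnals2021].
-/

noncomputable section

namespace Summit.CriticalPhenomena.Ising3DConformalLimit.UnitLightConeIsingEuclidUpgradeR4NonGaussianSplit

open Literature.Probability.LatticeModels Filter Set Finset
open scoped Topology BigOperators

/-! ## The two pieces (spelled out; every theorem below takes EXACTLY these statements as hypotheses)

* `Sub₁` MATCHED ISOTHERM DEFICIT (crux-child, OPEN):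
  `∀ ρ Δ S, (ρ > 0 on (0,1]) → HasPointwiseScalingLimit (criticalCorr 3) ρ S → IsNondegenerateTwoPoint S →
   IsScaleCovariant Δ S → ∃ C c > 0, ∃ᶠ L, (2L+1)³ · m(β_c, C/√Σ_L) ≤ (1 - c) · β_c C √Σ_L`;
* `Sub₂` LEE–YANG SATURATION DEFICIT (support, provable now):
  `∀ L t, 0 ≤ t → 0 < ⟨e^{tM_L}⟩ ∧ (Σ_L t - t³(3Σ_L² - ⟨M_L⁴⟩))·⟨e^{tM_L}⟩ ≤ ⟨M_L e^{tM_L}⟩`.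
No `def` is introduced, so the children of the split are free-standing route decls and the glue below has
literally the type `Sub₂ → Sub₁ → Crux`. -/

/-! ## Real arithmetic at one block -/

/-- Deficit + domination + isotherm deficit give the Binder floor. With `Sg = Σ_L > 0`, `t = β C/√Sg`,
`K = 3Σ_L² - ⟨M_L⁴⟩`, `Z = ⟨e^{tM}⟩ > 0`: `(Sg t - t³K) Z ≤ T ≤ Nm Z` and `Nm ≤ (1 - c) β C √Sg` force
`c/(β²C²) ≤ K/Sg²`. -/
theorem binder_lower_of_deficit {β C c Sg K Z T Nm : ℝ} (hβ : 0 < β) (hC : 0 < C) (hSg : 0 < Sg)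
    (hZ : 0 < Z)
    (hdef : (Sg * (β * (C / Real.sqrt Sg)) - (β * (C / Real.sqrt Sg)) ^ 3 * K) * Z ≤ T)
    (hdom : T ≤ Nm * Z) (hiso : Nm ≤ (1 - c) * (β * C * Real.sqrt Sg)) :
    c / (β ^ 2 * C ^ 2) ≤ K / Sg ^ 2 := by
  set s : ℝ := Real.sqrt Sg with hs
  have hs0 : 0 < s := Real.sqrt_pos.2 hSg
  have hs2 : s ^ 2 = Sg := Real.sq_sqrt hSg.le
  set t : ℝ := β * (C / s) with ht
  have ht0 : 0 < t := by positivity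
  -- cancel `Z`
  have h1 : Sg * t - t ^ 3 * K ≤ Nm := le_of_mul_le_mul_right (hdef.trans hdom) hZ
  -- `Nm ≤ (1 - c) t Sg`
  have h2 : β * C * s = t * Sg := by
    rw [ht, ← hs2]; field_simp
  have h3 : Sg * t - t ^ 3 * K ≤ (1 - c) * (t * Sg) := by
    have := h1.trans hiso
    rwa [h2] at this
  -- hence `c Sg ≤ t² K`
  have h4 : t * (c * Sg) ≤ t * (t ^ 2 * K) := by nlinarith
  have h5 : c * Sg ≤ t ^ 2 * K := le_of_mul_le_mul_left h4 ht0
  -- `t² Sg = β² C²`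
  have h6 : t ^ 2 * Sg = β ^ 2 * C ^ 2 := by
    rw [ht, ← hs2]; field_simp
  have hSg2 : 0 < Sg ^ 2 := by positivity
  have hSg0 : 0 ≤ Sg := hSg.le
  rw [div_le_div_iff₀ (by positivity) hSg2]
  calc c * Sg ^ 2 = (c * Sg) * Sg := by ring
    _ ≤ (t ^ 2 * K) * Sg := mul_le_mul_of_nonneg_right h5 hSg0
    _ = K * (t ^ 2 * Sg) := by ring
    _ = K * (β ^ 2 * C ^ 2) := by rw [h6]

/-- **Sub₂ + GKS block-field domination + Sub₁ give a Binder floor along a subsequence** (for a given limit):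
`∃ c₀ > 0, ∃ᶠ L, c₀ ≤ g_L`. -/
theorem frequently_binder_ge
    (hdef : (∀ (L : ℕ) (t : ℝ), 0 ≤ t →
      0 < plusExpect 3 (criticalBeta 3) 0 (fun σ => Real.exp (t * ∑ x ∈ box 3 L, spinAt x σ)) ∧
      (plusExpect 3 (criticalBeta 3) 0 (fun σ => (∑ x ∈ box 3 L, spinAt x σ) ^ 2) * t -
          t ^ 3 * (3 * (plusExpect 3 (criticalBeta 3) 0 (fun σ => (∑ x ∈ box 3 L, spinAt x σ) ^ 2)) ^ 2 -
            plusExpect 3 (criticalBeta 3) 0 (fun σ => (∑ x ∈ box 3 L, spinAt x σ) ^ 4))) *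
        plusExpect 3 (criticalBeta 3) 0 (fun σ => Real.exp (t * ∑ x ∈ box 3 L, spinAt x σ)) ≤
      plusExpect 3 (criticalBeta 3) 0
        (fun σ => (∑ x ∈ box 3 L, spinAt x σ) * Real.exp (t * ∑ x ∈ box 3 L, spinAt x σ))))
    (hiso : (∀ (ρ : ℝ → ℝ) (Δ : ℝ) (S : CorrFamily 3), (∀ δ ∈ Set.Ioc (0:ℝ) 1, 0 < ρ δ) →
      HasPointwiseScalingLimit (criticalCorr 3) ρ S → IsNondegenerateTwoPoint S → IsScaleCovariant Δ S →
      ∃ C c : ℝ, 0 < C ∧ 0 < c ∧ ∃ᶠ L : ℕ in atTop,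
        (2 * (L : ℝ) + 1) ^ 3 * magnetizationInField 3 (criticalBeta 3)
            (C / Real.sqrt (plusExpect 3 (criticalBeta 3) 0 (fun σ => (∑ x ∈ box 3 L, spinAt x σ) ^ 2))) ≤
          (1 - c) * (criticalBeta 3 * C *
            Real.sqrt (plusExpect 3 (criticalBeta 3) 0 (fun σ => (∑ x ∈ box 3 L, spinAt x σ) ^ 2)))))
    {ρ : ℝ → ℝ} {Δ : ℝ} {S : CorrFamily 3}
    (hρ : ∀ δ ∈ Set.Ioc (0:ℝ) 1, 0 < ρ δ) (hlim : HasPointwiseScalingLimit (criticalCorr 3) ρ S)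
    (hnd : IsNondegenerateTwoPoint S) (hsc : IsScaleCovariant Δ S) :
    ∃ c₀ : ℝ, 0 < c₀ ∧ ∃ᶠ L : ℕ in atTop,
      c₀ ≤ (3 * (plusExpect 3 (criticalBeta 3) 0 (fun σ => (∑ x ∈ box 3 L, spinAt x σ) ^ 2)) ^ 2 -
              plusExpect 3 (criticalBeta 3) 0 (fun σ => (∑ x ∈ box 3 L, spinAt x σ) ^ 4)) /
            (plusExpect 3 (criticalBeta 3) 0 (fun σ => (∑ x ∈ box 3 L, spinAt x σ) ^ 2)) ^ 2 := by
  have hβ : 0 < criticalBeta 3 := criticalBeta_pos_holds (d := 3) (by norm_num)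
  obtain ⟨C, c, hC, hc, hfr⟩ := hiso ρ Δ S hρ hlim hnd hsc
  refine ⟨c / (criticalBeta 3 ^ 2 * C ^ 2), by positivity, ?_⟩
  refine hfr.mono fun L hL => ?_
  set Sg : ℝ := plusExpect 3 (criticalBeta 3) 0 (fun σ => (∑ x ∈ box 3 L, spinAt x σ) ^ 2) with hSgdef
  have hSg : 0 < Sg := by
    simpa [hSgdef, Literature.Barriers.CriticalPhenomena.blockVariance,
      Literature.Barriers.CriticalPhenomena.blockSpin] using
      Literature.Barriers.CriticalPhenomena.blockVariance_pos (d := 3) (criticalBeta_nonneg 3) L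
  set h : ℝ := C / Real.sqrt Sg with hh
  have hh0 : 0 ≤ h := by positivity
  -- domination at field `h` (tilt `β_c h`)
  have hdom := Summit.CriticalPhenomena.Ising3DConformalLimit.PerfectScreeningCoulombImpliesNontrivial.stub_blockFieldDomination
    L h hh0
  -- deficit at tilt `t = β_c h`
  obtain ⟨hZ, hdefL⟩ := hdef L (criticalBeta 3 * h) (by positivity)
  have key := binder_lower_of_deficit (β := criticalBeta 3) (C := C) (c := c) (Sg := Sg)
    (K := 3 * Sg ^ 2 - plusExpect 3 (criticalBeta 3) 0 (fun σ => (∑ x ∈ box 3 L, spinAt x σ) ^ 4))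
    hβ hC hSg hZ (by simpa [hh, mul_assoc] using hdefL) hdom (by simpa [hh] using hL)
  simpa [hSgdef] using key

/-- Normalisation glue: every non-degenerate pointwise limit has a normalisation `S'` (zero off
`NonCoincident`) that is again a non-degenerate pointwise limit with the same `ρ`, is scale covariant with
the automatic dimension, and whose `U₄`-non-triviality implies that of `S`. -/
theorem exists_normalised {ρ : ℝ → ℝ} {S : CorrFamily 3}
    (hρ : ∀ δ ∈ Set.Ioc (0:ℝ) 1, 0 < ρ δ) (hlim : HasPointwiseScalingLimit (criticalCorr 3) ρ S)
    (hnd : IsNondegenerateTwoPoint S) :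
    ∃ (Δ : ℝ) (S' : CorrFamily 3), HasPointwiseScalingLimit (criticalCorr 3) ρ S' ∧
      IsNondegenerateTwoPoint S' ∧ IsScaleCovariant Δ S' ∧ (HasNontrivialU4 S' → HasNontrivialU4 S) := by
  classical
  set S' : CorrFamily 3 := fun n z => if Function.Injective z then S n z else 0 with hS'
  have S'_inj : ∀ {n : ℕ} {z : Fin n → EuclideanSpace ℝ (Fin 3)}, Function.Injective z →
      S' n z = S n z := fun hz => by simp only [hS', if_pos hz]
  have S'_ninj : ∀ {n : ℕ} {z : Fin n → EuclideanSpace ℝ (Fin 3)}, ¬ Function.Injective z →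
      S' n z = 0 := fun hz => by simp only [hS', if_neg hz]
  have hlim' : HasPointwiseScalingLimit (criticalCorr 3) ρ S' :=
    fun n => (hlim n).congr_right fun z hz => (S'_inj hz).symm
  have hnd' : IsNondegenerateTwoPoint S' := fun z hz => by rw [S'_inj hz]; exact hnd z hz
  obtain ⟨Δ, -, hcov⟩ := hlim'.exists_rpow_scale_mem_Icc hρ hnd'
  have hsc' : IsScaleCovariant Δ S' := by
    intro n c hc z
    by_cases hz : Function.Injective z
    · exact hcov n c hc z hz
    · have hz' : ¬ Function.Injective (fun i => c • z i) := fun h =>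
        hz ((smul_right_injective (EuclideanSpace ℝ (Fin 3)) hc.ne').of_comp_iff z |>.1 h)
      rw [S'_ninj hz', S'_ninj hz, mul_zero]
  refine ⟨Δ, S', hlim', hnd', hsc', ?_⟩
  rintro ⟨x, hx, hne⟩
  refine ⟨x, hx, ?_⟩
  have hinj : Function.Injective x := hx
  have hpair : ∀ i j : Fin 4, i ≠ j → S' 2 ![x i, x j] = S 2 ![x i, x j] := by
    intro i j hij
    exact S'_inj (pair_mem_nonCoincident (d := 3) fun h => hij (hinj h))
  have h4 : S' 4 x = S 4 x := S'_inj hinj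
  simp only [limitConnectedFour] at hne ⊢
  rwa [h4, hpair 0 1 (by decide), hpair 2 3 (by decide), hpair 0 2 (by decide), hpair 1 3 (by decide),
    hpair 0 3 (by decide), hpair 1 2 (by decide)] at hne

/-! ## The glue `Sub₂ → Sub₁ → Crux` (sorry-free) -/

/-- **GLUE of the split.** `Sub₂ → Sub₁ → IsingEuclidUpgradeR4NonGaussian` — the UnitLightCone decl of item
stmt-CriticalPhenomena-0636, by name. -/
theorem IsingEuclidUpgradeR4NonGaussian_of_subs :
    (∀ (L : ℕ) (t : ℝ), 0 ≤ t →
      0 < plusExpect 3 (criticalBeta 3) 0 (fun σ => Real.exp (t * ∑ x ∈ box 3 L, spinAt x σ)) ∧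
      (plusExpect 3 (criticalBeta 3) 0 (fun σ => (∑ x ∈ box 3 L, spinAt x σ) ^ 2) * t -
          t ^ 3 * (3 * (plusExpect 3 (criticalBeta 3) 0 (fun σ => (∑ x ∈ box 3 L, spinAt x σ) ^ 2)) ^ 2 -
            plusExpect 3 (criticalBeta 3) 0 (fun σ => (∑ x ∈ box 3 L, spinAt x σ) ^ 4))) *
        plusExpect 3 (criticalBeta 3) 0 (fun σ => Real.exp (t * ∑ x ∈ box 3 L, spinAt x σ)) ≤
      plusExpect 3 (criticalBeta 3) 0
        (fun σ => (∑ x ∈ box 3 L, spinAt x σ) * Real.exp (t * ∑ x ∈ box 3 L, spinAt x σ))) →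
    (∀ (ρ : ℝ → ℝ) (Δ : ℝ) (S : CorrFamily 3), (∀ δ ∈ Set.Ioc (0:ℝ) 1, 0 < ρ δ) →
      HasPointwiseScalingLimit (criticalCorr 3) ρ S → IsNondegenerateTwoPoint S → IsScaleCovariant Δ S →
      ∃ C c : ℝ, 0 < C ∧ 0 < c ∧ ∃ᶠ L : ℕ in atTop,
        (2 * (L : ℝ) + 1) ^ 3 * magnetizationInField 3 (criticalBeta 3)
            (C / Real.sqrt (plusExpect 3 (criticalBeta 3) 0 (fun σ => (∑ x ∈ box 3 L, spinAt x σ) ^ 2))) ≤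
          (1 - c) * (criticalBeta 3 * C *
            Real.sqrt (plusExpect 3 (criticalBeta 3) 0 (fun σ => (∑ x ∈ box 3 L, spinAt x σ) ^ 2)))) →
    Summit.CriticalPhenomena.Ising3DConformalLimit.Theses.UnitLightCone.IsingEuclidUpgradeR4NonGaussian := by
  intro hdef hiso ρ S hρ hlim hnd
  obtain ⟨Δ, S', hlim', hnd', hsc', hback⟩ := exists_normalised hρ hlim hnd
  refine hback ?_
  by_contra hU4
  have htend := Summit.CriticalPhenomena.Ising3DConformalLimit.LeeYangGapGaussianLimitKillsBlockCoupling.gaussianLimitKillsBlockCoupling_proof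
    ρ Δ S' hρ hlim' hnd' hsc' hU4
  obtain ⟨c₀, hc₀, hlow⟩ := frequently_binder_ge hdef hiso hρ hlim' hnd' hsc'
  have hup := htend.eventually (gt_mem_nhds hc₀)
  obtain ⟨L, h1, h2⟩ := (hlow.and_eventually hup).exists
  exact absurd h1 (not_le.2 h2)

/-- The same glue for the IsingEuclidUpgrade copy of the shared decl (definitionally the same statement). -/
theorem IsingEuclidUpgradeR4NonGaussian_of_subs_isingEuclidUpgrade :
    (∀ (L : ℕ) (t : ℝ), 0 ≤ t →
      0 < plusExpect 3 (criticalBeta 3) 0 (fun σ => Real.exp (t * ∑ x ∈ box 3 L, spinAt x σ)) ∧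
      (plusExpect 3 (criticalBeta 3) 0 (fun σ => (∑ x ∈ box 3 L, spinAt x σ) ^ 2) * t -
          t ^ 3 * (3 * (plusExpect 3 (criticalBeta 3) 0 (fun σ => (∑ x ∈ box 3 L, spinAt x σ) ^ 2)) ^ 2 -
            plusExpect 3 (criticalBeta 3) 0 (fun σ => (∑ x ∈ box 3 L, spinAt x σ) ^ 4))) *
        plusExpect 3 (criticalBeta 3) 0 (fun σ => Real.exp (t * ∑ x ∈ box 3 L, spinAt x σ)) ≤
      plusExpect 3 (criticalBeta 3) 0
        (fun σ => (∑ x ∈ box 3 L, spinAt x σ) * Real.exp (t * ∑ x ∈ box 3 L, spinAt x σ))) →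
    (∀ (ρ : ℝ → ℝ) (Δ : ℝ) (S : CorrFamily 3), (∀ δ ∈ Set.Ioc (0:ℝ) 1, 0 < ρ δ) →
      HasPointwiseScalingLimit (criticalCorr 3) ρ S → IsNondegenerateTwoPoint S → IsScaleCovariant Δ S →
      ∃ C c : ℝ, 0 < C ∧ 0 < c ∧ ∃ᶠ L : ℕ in atTop,
        (2 * (L : ℝ) + 1) ^ 3 * magnetizationInField 3 (criticalBeta 3)
            (C / Real.sqrt (plusExpect 3 (criticalBeta 3) 0 (fun σ => (∑ x ∈ box 3 L, spinAt x σ) ^ 2))) ≤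
          (1 - c) * (criticalBeta 3 * C *
            Real.sqrt (plusExpect 3 (criticalBeta 3) 0 (fun σ => (∑ x ∈ box 3 L, spinAt x σ) ^ 2)))) →
    Summit.CriticalPhenomena.Ising3DConformalLimit.Theses.IsingEuclidUpgrade.IsingEuclidUpgradeR4NonGaussian :=
  fun hdef hiso => IsingEuclidUpgradeR4NonGaussian_of_subs hdef hiso

/-- … and for the HyperoctahedralRP copy. -/
theorem IsingEuclidUpgradeR4NonGaussian_of_subs_hyperoctahedralRP :
    (∀ (L : ℕ) (t : ℝ), 0 ≤ t →
      0 < plusExpect 3 (criticalBeta 3) 0 (fun σ => Real.exp (t * ∑ x ∈ box 3 L, spinAt x σ)) ∧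
      (plusExpect 3 (criticalBeta 3) 0 (fun σ => (∑ x ∈ box 3 L, spinAt x σ) ^ 2) * t -
          t ^ 3 * (3 * (plusExpect 3 (criticalBeta 3) 0 (fun σ => (∑ x ∈ box 3 L, spinAt x σ) ^ 2)) ^ 2 -
            plusExpect 3 (criticalBeta 3) 0 (fun σ => (∑ x ∈ box 3 L, spinAt x σ) ^ 4))) *
        plusExpect 3 (criticalBeta 3) 0 (fun σ => Real.exp (t * ∑ x ∈ box 3 L, spinAt x σ)) ≤
      plusExpect 3 (criticalBeta 3) 0
        (fun σ => (∑ x ∈ box 3 L, spinAt x σ) * Real.exp (t * ∑ x ∈ box 3 L, spinAt x σ))) →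
    (∀ (ρ : ℝ → ℝ) (Δ : ℝ) (S : CorrFamily 3), (∀ δ ∈ Set.Ioc (0:ℝ) 1, 0 < ρ δ) →
      HasPointwiseScalingLimit (criticalCorr 3) ρ S → IsNondegenerateTwoPoint S → IsScaleCovariant Δ S →
      ∃ C c : ℝ, 0 < C ∧ 0 < c ∧ ∃ᶠ L : ℕ in atTop,
        (2 * (L : ℝ) + 1) ^ 3 * magnetizationInField 3 (criticalBeta 3)
            (C / Real.sqrt (plusExpect 3 (criticalBeta 3) 0 (fun σ => (∑ x ∈ box 3 L, spinAt x σ) ^ 2))) ≤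
          (1 - c) * (criticalBeta 3 * C *
            Real.sqrt (plusExpect 3 (criticalBeta 3) 0 (fun σ => (∑ x ∈ box 3 L, spinAt x σ) ^ 2)))) →
    Summit.CriticalPhenomena.Ising3DConformalLimit.Theses.HyperoctahedralRP.IsingEuclidUpgradeR4NonGaussian :=
  fun hdef hiso => IsingEuclidUpgradeR4NonGaussian_of_subs hdef hiso

/-! ## The registered line feeds `Sub₁` -/

/-- The registered stub S1 of line `isotherm-saturation-lee-yang` (`stub_matchedUpperIsotherm`: deficit `1/2`,
eventually in `L`) implies `Sub₁` (deficit `c = 1/2`, frequently); composed with the glue, this re-derives the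
line's composition, so the line and the split are interchangeable entrances. -/
theorem matchedIsothermDeficit_of_matchedUpperIsotherm
    (hS1 : (∀ (ρ : ℝ → ℝ) (Δ : ℝ) (S : CorrFamily 3), (∀ δ ∈ Set.Ioc (0:ℝ) 1, 0 < ρ δ) →
      HasPointwiseScalingLimit (criticalCorr 3) ρ S → IsNondegenerateTwoPoint S →
      IsScaleCovariant Δ S →
      ∃ C : ℝ, 0 < C ∧ ∀ᶠ L : ℕ in atTop,
        (2 * (L : ℝ) + 1) ^ 3 * magnetizationInField 3 (criticalBeta 3)
            (C / Real.sqrt (plusExpect 3 (criticalBeta 3) 0 (fun σ => (∑ x ∈ box 3 L, spinAt x σ) ^ 2))) ≤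
          criticalBeta 3 * C / 2 *
            Real.sqrt (plusExpect 3 (criticalBeta 3) 0 (fun σ => (∑ x ∈ box 3 L, spinAt x σ) ^ 2)))) :
    (∀ (ρ : ℝ → ℝ) (Δ : ℝ) (S : CorrFamily 3), (∀ δ ∈ Set.Ioc (0:ℝ) 1, 0 < ρ δ) →
      HasPointwiseScalingLimit (criticalCorr 3) ρ S → IsNondegenerateTwoPoint S → IsScaleCovariant Δ S →
      ∃ C c : ℝ, 0 < C ∧ 0 < c ∧ ∃ᶠ L : ℕ in atTop,
        (2 * (L : ℝ) + 1) ^ 3 * magnetizationInField 3 (criticalBeta 3)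
            (C / Real.sqrt (plusExpect 3 (criticalBeta 3) 0 (fun σ => (∑ x ∈ box 3 L, spinAt x σ) ^ 2))) ≤
          (1 - c) * (criticalBeta 3 * C *
            Real.sqrt (plusExpect 3 (criticalBeta 3) 0 (fun σ => (∑ x ∈ box 3 L, spinAt x σ) ^ 2)))) := by
  intro ρ Δ S hρ hlim hnd hsc
  obtain ⟨C, hC, hev⟩ := hS1 ρ Δ S hρ hlim hnd hsc
  refine ⟨C, 1 / 2, hC, by norm_num, ?_⟩
  refine (hev.mono fun L hL => ?_).frequently
  convert hL using 1
  ring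

/-- Hence the line's two hard stubs (S2 = `Sub₂`, S1) already give the crux through the split's glue. -/
theorem IsingEuclidUpgradeR4NonGaussian_of_line
    (hS2 : (∀ (L : ℕ) (t : ℝ), 0 ≤ t →
      0 < plusExpect 3 (criticalBeta 3) 0 (fun σ => Real.exp (t * ∑ x ∈ box 3 L, spinAt x σ)) ∧
      (plusExpect 3 (criticalBeta 3) 0 (fun σ => (∑ x ∈ box 3 L, spinAt x σ) ^ 2) * t -
          t ^ 3 * (3 * (plusExpect 3 (criticalBeta 3) 0 (fun σ => (∑ x ∈ box 3 L, spinAt x σ) ^ 2)) ^ 2 -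
            plusExpect 3 (criticalBeta 3) 0 (fun σ => (∑ x ∈ box 3 L, spinAt x σ) ^ 4))) *
        plusExpect 3 (criticalBeta 3) 0 (fun σ => Real.exp (t * ∑ x ∈ box 3 L, spinAt x σ)) ≤
      plusExpect 3 (criticalBeta 3) 0
        (fun σ => (∑ x ∈ box 3 L, spinAt x σ) * Real.exp (t * ∑ x ∈ box 3 L, spinAt x σ))))
    (hS1 : (∀ (ρ : ℝ → ℝ) (Δ : ℝ) (S : CorrFamily 3), (∀ δ ∈ Set.Ioc (0:ℝ) 1, 0 < ρ δ) →
      HasPointwiseScalingLimit (criticalCorr 3) ρ S → IsNondegenerateTwoPoint S →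
      IsScaleCovariant Δ S →
      ∃ C : ℝ, 0 < C ∧ ∀ᶠ L : ℕ in atTop,
        (2 * (L : ℝ) + 1) ^ 3 * magnetizationInField 3 (criticalBeta 3)
            (C / Real.sqrt (plusExpect 3 (criticalBeta 3) 0 (fun σ => (∑ x ∈ box 3 L, spinAt x σ) ^ 2))) ≤
          criticalBeta 3 * C / 2 *
            Real.sqrt (plusExpect 3 (criticalBeta 3) 0 (fun σ => (∑ x ∈ box 3 L, spinAt x σ) ^ 2)))) :
    Summit.CriticalPhenomena.Ising3DConformalLimit.Theses.UnitLightCone.IsingEuclidUpgradeR4NonGaussian :=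
  IsingEuclidUpgradeR4NonGaussian_of_subs hS2 (matchedIsothermDeficit_of_matchedUpperIsotherm hS1)

end Summit.CriticalPhenomena.Ising3DConformalLimit.UnitLightConeIsingEuclidUpgradeR4NonGaussianSplit

end
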